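import Summits.PneNP.PneNP.Theses.PhaseTwins
import Literature.ModelTheory.FiniteModelTheory.CkEquivHomCount
import Literature.ModelTheory.FiniteModelTheory.CountingWidth

/-!
# Negative lemma for crux `PhaseTwins.PolyDepthTwinsAbove` (stmt-PneNP-2719): the depth-exponent ceiling

The crux asks, for every `Δ ≥ 3` and `λ > λ_c(Δ)`, for SOME exponent `θ > 0` and infinitely many `n` with
max-degree-`Δ` graphs `G, H` on `n` vertices that are homomorphism-indistinguishable over all graphs of
treewidth `< n^θ` and have `Z_G(λ) ≥ 2·Z_H(λ)`.  This file proves, sorry-free, the natural STRENGTHENING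
with `θ ≥ 1` false, for every `Δ` and every `λ ≥ 0`: hom-indistinguishability below depth `n^θ ≥ n` is
`≡_{C^n}` by the tree's PROVED Dvořák bridge (`Dvorak2010_ckEquiv_iff_homCount_holds`), `n` pebble pairs
decide isomorphism (`CkEquiv.nonempty_iso`, PROVED), and the hard-core sum is an isomorphism invariant, so
`Z_G = Z_H > 0` contradicts the factor-`2` gap.  Hence ANY witnessing exponent of the crux lies in `(0,1)`
(`depthExponent_lt_one`, `depthExponent_lt_one_of_polyDepthTwinsAbove`) — the kernel-checked form of
Disproof.lean §3(i) (cdisprove gen 3; the mutated statement is written INLINE in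
`polyDepthTwinsAbove_false_at_exponent_ge_one`, as in `LoadBearing.lean`). [folklore]
-/

set_option linter.dupNamespace false

namespace Summit.PneNP.PneNP.Theorems.PolyDepthTwinsAbove.Negative

open scoped BigOperators Classical
open Literature.ModelTheory.FiniteModelTheory (CkEquiv Dvorak2010_ckEquiv_iff_homCount_holds)

/-- Independence is transported along a graph isomorphism. -/
theorem isIndepSet_map_iff {n : ℕ} {G H : SimpleGraph (Fin n)} (e : G ≃g H) (I : Finset (Fin n)) :
    H.IsIndepSet (↑(I.map e.toEquiv.toEmbedding) : Set (Fin n)) ↔ G.IsIndepSet (↑I : Set (Fin n)) := by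
  constructor
  · intro h a ha b hb hab hadj
    have ha' : e a ∈ I.map e.toEquiv.toEmbedding := Finset.mem_map.2 ⟨a, ha, rfl⟩
    have hb' : e b ∈ I.map e.toEquiv.toEmbedding := Finset.mem_map.2 ⟨b, hb, rfl⟩
    have hne : e a ≠ e b := fun h' => hab (e.injective h')
    exact h (Finset.mem_coe.2 ha') (Finset.mem_coe.2 hb') hne ((e.map_adj_iff).2 hadj)
  · intro h x hx y hy hxy hadj
    obtain ⟨a, ha, rfl⟩ := Finset.mem_map.1 (Finset.mem_coe.1 hx)
    obtain ⟨b, hb, rfl⟩ := Finset.mem_map.1 (Finset.mem_coe.1 hy)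
    have hab : a ≠ b := fun h' => hxy (by simp [h'])
    exact h (Finset.mem_coe.2 ha) (Finset.mem_coe.2 hb) hab ((e.map_adj_iff).1 hadj)

/-- **The hard-core sum of the crux is an isomorphism invariant.** -/
theorem hardcoreSum_eq_of_iso {n : ℕ} {G H : SimpleGraph (Fin n)} (e : G ≃g H) (lam : ℝ) :
    (∑ I : Finset (Fin n), (if G.IsIndepSet (↑I : Set (Fin n)) then lam ^ I.card else 0)) =
      ∑ I : Finset (Fin n), (if H.IsIndepSet (↑I : Set (Fin n)) then lam ^ I.card else 0) := by
  refine Fintype.sum_equiv (Equiv.finsetCongr e.toEquiv) _ _ fun I => ?_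
  rw [Equiv.finsetCongr_apply, Finset.card_map]
  by_cases hI : G.IsIndepSet (↑I : Set (Fin n))
  · rw [if_pos hI, if_pos ((isIndepSet_map_iff e I).2 hI)]
  · rw [if_neg hI, if_neg (fun h => hI ((isIndepSet_map_iff e I).1 h))]

/-- The hard-core sum is positive for `λ ≥ 0` (the empty set contributes `1`). -/
theorem hardcoreSum_pos {n : ℕ} (G : SimpleGraph (Fin n)) {lam : ℝ} (hlam : 0 ≤ lam) :
    0 < ∑ I : Finset (Fin n), (if G.IsIndepSet (↑I : Set (Fin n)) then lam ^ I.card else 0) := by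
  have hterm : ∀ I : Finset (Fin n), 0 ≤ (if G.IsIndepSet (↑I : Set (Fin n)) then lam ^ I.card else 0) :=
    fun I => by split_ifs <;> [exact pow_nonneg hlam _; exact le_rfl]
  have hempty : (if G.IsIndepSet (↑(∅ : Finset (Fin n)) : Set (Fin n)) then lam ^ (∅ : Finset (Fin n)).card
      else 0) = (1 : ℝ) := by
    have h : G.IsIndepSet ((∅ : Finset (Fin n)) : Set (Fin n)) := by
      simp [SimpleGraph.IsIndepSet, Set.Pairwise]
    rw [if_pos h]
    simp
  calc (0 : ℝ) < 1 := one_pos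
    _ = _ := hempty.symm
    _ ≤ _ := Finset.single_le_sum (fun I _ => hterm I) (Finset.mem_univ (∅ : Finset (Fin n)))

/-- **Hom-indistinguishability below depth `n` is isomorphism** (graphs on `n ≥ 2` vertices): equal hom
counts from every graph of treewidth `< n` give `≡_{C^n}` by the Dvořák–Dell–Grohe–Rattan bridge (PROVED in
the tree), and `n` pebble pairs on `n` vertices decide isomorphism (`CkEquiv.nonempty_iso`, PROVED). -/
theorem nonempty_iso_of_homIndist_card {n : ℕ} (hn : 2 ≤ n) {G H : SimpleGraph (Fin n)}
    (h : ∀ (m : ℕ) (F : SimpleGraph (Fin m)), Literature.Combinatorics.SimpleGraph.treewidth F < n →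
      Nat.card (F →g G) = Nat.card (F →g H)) : Nonempty (G ≃g H) := by
  have hck : CkEquiv n G H := (Dvorak2010_ckEquiv_iff_homCount_holds n hn n n G H).2 h
  exact hck.nonempty_iso (by omega) (by simp)

/-- **At depth exponent `θ ≥ 1` the hom-count hypothesis of the crux pins `Z` EXACTLY** (`n ≥ 2`, any real
`λ`): `n^θ ≥ n`, so every test graph of treewidth `< n` is admitted, the graphs are isomorphic, and the
hard-core sums agree. -/
theorem hardcoreSum_eq_of_homIndist_rpow {n : ℕ} (hn : 2 ≤ n) {θ : ℝ} (hθ : 1 ≤ θ)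
    {G H : SimpleGraph (Fin n)}
    (h : ∀ (m : ℕ) (F : SimpleGraph (Fin m)),
      (Literature.Combinatorics.SimpleGraph.treewidth F : ℝ) < (n : ℝ) ^ θ →
        Nat.card (F →g G) = Nat.card (F →g H)) (lam : ℝ) :
    (∑ I : Finset (Fin n), (if G.IsIndepSet (↑I : Set (Fin n)) then lam ^ I.card else 0)) =
      ∑ I : Finset (Fin n), (if H.IsIndepSet (↑I : Set (Fin n)) then lam ^ I.card else 0) := by
  have hn1 : (1 : ℝ) ≤ n := by exact_mod_cast (show 1 ≤ n by omega)
  have hpow : (n : ℝ) ≤ (n : ℝ) ^ θ := by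
    calc (n : ℝ) = (n : ℝ) ^ (1 : ℝ) := (Real.rpow_one _).symm
      _ ≤ (n : ℝ) ^ θ := Real.rpow_le_rpow_of_exponent_le hn1 hθ
  have h' : ∀ (m : ℕ) (F : SimpleGraph (Fin m)), Literature.Combinatorics.SimpleGraph.treewidth F < n →
      Nat.card (F →g G) = Nat.card (F →g H) := by
    intro m F hF
    refine h m F (lt_of_lt_of_le ?_ hpow)
    exact_mod_cast hF
  obtain ⟨e⟩ := nonempty_iso_of_homIndist_card hn h'
  exact hardcoreSum_eq_of_iso e lam

/-- **The depth exponent of any witness family is `< 1`** (every `Δ`, every `λ ≥ 0`): if for arbitrarily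
large `n` there are graphs on `n` vertices, hom-indistinguishable below depth `n^θ`, with `2·Z_H(λ) ≤ Z_G(λ)`,
then `θ < 1`.  (No degree bound and no threshold are needed for this direction.) -/
theorem depthExponent_lt_one {θ lam : ℝ} (hlam : 0 ≤ lam)
    (h : ∀ n₀ : ℕ, ∃ (n : ℕ) (G H : SimpleGraph (Fin n)), n₀ ≤ n ∧
      (∀ (m : ℕ) (F : SimpleGraph (Fin m)),
        (Literature.Combinatorics.SimpleGraph.treewidth F : ℝ) < (n : ℝ) ^ θ →
          Nat.card (F →g G) = Nat.card (F →g H)) ∧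
      2 * (∑ I : Finset (Fin n), (if H.IsIndepSet (↑I : Set (Fin n)) then lam ^ I.card else 0)) ≤
        ∑ I : Finset (Fin n), (if G.IsIndepSet (↑I : Set (Fin n)) then lam ^ I.card else 0)) :
    θ < 1 := by
  by_contra hθ
  push Not at hθ
  obtain ⟨n, G, H, hn, hhom, hZ⟩ := h 2
  rw [hardcoreSum_eq_of_homIndist_rpow hn hθ hhom lam] at hZ
  have hpos := hardcoreSum_pos H hlam
  linarith

/-- **The strengthening of the crux to a depth exponent `θ ≥ 1` is false.** The statement inside the
negation is `PhaseTwins.PolyDepthTwinsAbove` with `∃ θ : ℝ, 0 < θ ∧ …` replaced by a GIVEN `θ ≥ 1`; it fails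
already at `Δ = 3`, `λ = 5 > 4 = λ_c(3)` (any admissible pair would do), by `depthExponent_lt_one`. So the crux
lives entirely in `θ ∈ (0, 1)`: a witness family can at best have depth `n^{1-o(1)}`, never treewidth bound `n`
itself (bare CFI graphs over cubic expanders show `≡_{C^{Ω(n)}}` without isomorphism IS possible — the ceiling
concerns the exponent, not the mechanism). -/
theorem polyDepthTwinsAbove_false_at_exponent_ge_one {θ : ℝ} (hθ : 1 ≤ θ) :
    ¬ (∀ Δ : ℕ, 3 ≤ Δ → ∀ lam : ℝ, ((Δ : ℝ) - 1) ^ (Δ - 1) / ((Δ : ℝ) - 2) ^ Δ < lam → ∀ n₀ : ℕ,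
      ∃ (n : ℕ) (G H : SimpleGraph (Fin n)), n₀ ≤ n ∧ G.maxDegree ≤ Δ ∧ H.maxDegree ≤ Δ ∧
      (∀ (m : ℕ) (F : SimpleGraph (Fin m)),
        (Literature.Combinatorics.SimpleGraph.treewidth F : ℝ) < (n : ℝ) ^ θ →
          Nat.card (F →g G) = Nat.card (F →g H)) ∧
      2 * (∑ I : Finset (Fin n), (if H.IsIndepSet (↑I : Set (Fin n)) then lam ^ I.card else 0)) ≤
        ∑ I : Finset (Fin n), (if G.IsIndepSet (↑I : Set (Fin n)) then lam ^ I.card else 0)) := by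
  intro h
  have h35 := h 3 le_rfl 5 (by norm_num)
  have hlt : θ < 1 :=
    depthExponent_lt_one (lam := 5) (by norm_num) fun n₀ => by
      obtain ⟨n, G, H, hn, -, -, hhom, hZ⟩ := h35 n₀
      exact ⟨n, G, H, hn, hhom, hZ⟩
  linarith

/-- **Corollary for the crux as filed:** every exponent `θ` that `PolyDepthTwinsAbove` provides at some
`(Δ, λ)` with `λ ≥ 0` is `< 1` (so in `(0, 1)`). Stated against the crux's own body: IF the crux holds then at
each admissible `(Δ, λ)` the witnessing `θ` it yields is below `1`. (A consequence of the crux, not a proof of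
it; recorded so that planners quoting "depth `n^θ`" know `θ < 1` is forced.) -/
theorem depthExponent_lt_one_of_polyDepthTwinsAbove
    (h : Summit.PneNP.PneNP.Theses.PhaseTwins.PolyDepthTwinsAbove) {Δ : ℕ} (hΔ : 3 ≤ Δ) {lam : ℝ}
    (hlam : ((Δ : ℝ) - 1) ^ (Δ - 1) / ((Δ : ℝ) - 2) ^ Δ < lam) (hlam0 : 0 ≤ lam) :
    ∃ θ : ℝ, 0 < θ ∧ θ < 1 ∧ ∀ n₀ : ℕ, ∃ (n : ℕ) (G H : SimpleGraph (Fin n)), n₀ ≤ n ∧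
      G.maxDegree ≤ Δ ∧ H.maxDegree ≤ Δ ∧
      (∀ (m : ℕ) (F : SimpleGraph (Fin m)),
        (Literature.Combinatorics.SimpleGraph.treewidth F : ℝ) < (n : ℝ) ^ θ →
          Nat.card (F →g G) = Nat.card (F →g H)) ∧
      2 * (∑ I : Finset (Fin n), (if H.IsIndepSet (↑I : Set (Fin n)) then lam ^ I.card else 0)) ≤
        ∑ I : Finset (Fin n), (if G.IsIndepSet (↑I : Set (Fin n)) then lam ^ I.card else 0) := by
  obtain ⟨θ, hθ, hw⟩ := h Δ hΔ lam hlam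
  refine ⟨θ, hθ, ?_, hw⟩
  exact depthExponent_lt_one hlam0 fun n₀ => by
    obtain ⟨n, G, H, hn, -, -, hhom, hZ⟩ := hw n₀
    exact ⟨n, G, H, hn, hhom, hZ⟩

end Summit.PneNP.PneNP.Theorems.PolyDepthTwinsAbove.Negative
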